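import Mathlib
import Literature.Computability.QuantumComplexity.SolovayKitaev.Shrink
import HarnessLib
import HarnessLib.Audit

-- provenance: harness21/H21/H21/Statements/QuantumAdvantage/Wave0.lean @ fe6eab2 (interim HEAD d8f2665); M5 mechanical rewrite
/-!
# Quantum advantage — wave 0 statements

Family `quantum-advantage` (peak: BQP ≠ BPP). This file states the two inventory items that are
statable over Mathlib alone:

* **quantum-advantage.S07** — the Solovay–Kitaev theorem (Kitaev 1997; Dawson–Nielsen,
  *The Solovay–Kitaev algorithm*, QIC 6 (2006), Theorem 1): a finite inverse-closed subset of
  `SU(n)` generating a dense subgroup `ε`-approximates every element of `SU(n)` in operator norm by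
  words of length `O(log^c (1/ε))`.
* **quantum-advantage.S18** — the Permanent Anti-Concentration Conjecture (PACC) of
  Aaronson–Arkhipov, *The computational complexity of linear optics*, Theory of Computing 9 (2013),
  §1.2.3, Conjecture 1.6: the permanent of an `n × n` matrix of i.i.d. standard complex Gaussians
  is rarely much smaller than `√(n!)`. A CONJECTURE in the source (a `Prop` here, no `_holds`);
  open 2011–2026, with a proof announced in the preprint Koehler–Leung, arXiv:2607.20329 (July
  2026, unrefereed at the time of writing) — see the docstring of
  `PermanentAntiConcentrationConjecture` and the proved reductions in
  `QuantumAdvantageWave0Proofs.lean`.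

Skipped: all other statements S01–S06, S08–S17, S19–S27 of the family (marked
`statable_today: false` in the gap inventory; they need complexity classes BQP/BPP/PP/PH, quantum
circuits, query models or sampling problems, none of which exist in Mathlib yet).

Design choices.
* `SU(n)` is `Matrix.specialUnitaryGroup n ℂ` (a submonoid of `Matrix n n ℂ`, a `Group` as a
  subtype). Its topology is the subspace topology of the (product) topology on matrices, which
  coincides with the operator-norm topology in finite dimension. The approximation error is measured
  in the `L²`-operator norm `Matrix.instL2OpNormedAddCommGroup`, activated via
  `open scoped Matrix.Norms.L2Operator`.
* Words over the gate set are `List`s of elements of `SU(n)` all lying in `G`, evaluated by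
  `List.prod`. The constants `C, c` in the length bound `C * log(1/ε)^c` depend on `n` and `G`
  only; `ε` ranges over `(0, 1/2]` so that `log (1/ε)` is bounded below (Dawson–Nielsen obtain
  `c = log 5 / log (3/2) ≈ 3.97`; we only assert existence of some exponent).
* The standard complex Gaussian `𝒩(0,1)_ℂ` has independent real and imaginary parts of variance
  `1/2` (density `π⁻¹ e^{-|z|²}`), built from `ProbabilityTheory.gaussianReal` and
  `Complex.measurableEquivRealProd`; the matrix ensemble is the product measure `Measure.pi` on
  `Fin n → Fin n → ℂ`, read as a matrix through `Matrix.of`.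
* "There exists a polynomial `p`" in PACC is rendered as `∃ C k, p(n, 1/δ) = C (n+1)^k (1+1/δ)^k`.
  Since enlarging `p` only shrinks the bad event, this is equivalent to quantifying over all
  bivariate polynomials that are eventually dominated by such a monomial bound (i.e. all of them),
  and it avoids the vacuous reading where `p` takes nonpositive values.
-/

namespace Literature.Computability.QuantumComplexity

open scoped Matrix.Norms.L2Operator

section SolovayKitaev

variable {n : Type*} [Fintype n] [DecidableEq n]

/-- A subset `G` of the special unitary group `SU(n) = Matrix.specialUnitaryGroup n ℂ` is a
*universal instruction set* in the sense of Dawson–Nielsen (2006, §2) if it is finite, closed under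
inverses, and generates a dense subgroup of `SU(n)`. [cite: DawsonNielsen2006, §2] -/
structure IsUniversalGateSet (G : Set (Matrix.specialUnitaryGroup n ℂ)) : Prop where
  /-- The instruction set is finite. -/
  finite : G.Finite
  /-- The instruction set is closed under inverses. -/
  inv_mem : ∀ g ∈ G, g⁻¹ ∈ G
  /-- The subgroup generated by `G` is dense in `SU(n)`. -/
  dense_closure : Dense (Subgroup.closure G : Set (Matrix.specialUnitaryGroup n ℂ))

/-- **quantum-advantage.S07** (Solovay–Kitaev theorem; Kitaev 1997, Dawson–Nielsen 2006 Thm 1,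
Nielsen–Chuang App. 3). Let `G ⊆ SU(n)` be a finite inverse-closed set generating a dense subgroup.
Then there are constants `C` and `c` such that for every `0 < ε ≤ 1/2` and every `U ∈ SU(n)` there
is a word `w` over `G` of length at most `C · log(1/ε)^c` whose product is within `ε` of `U` in the
`L²`-operator norm on `Matrix n n ℂ`. (Dawson–Nielsen: `c = log 5 / log (3/2) ≈ 3.97`.) [cite: Kitaev1997, Dawson–Nielsen 2006 Thm 1  Nielsen–Chuan] -/
def solovay_kitaev : Prop :=
  ∀ {G : Set (Matrix.specialUnitaryGroup n ℂ)} (hG : IsUniversalGateSet G),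
    ∃ C c : ℝ, 0 < C ∧ 0 < c ∧ ∀ ε : ℝ, 0 < ε → ε ≤ 1 / 2 →
      ∀ U : Matrix.specialUnitaryGroup n ℂ,
        ∃ w : List (Matrix.specialUnitaryGroup n ℂ), (∀ g ∈ w, g ∈ G) ∧
          (w.length : ℝ) ≤ C * Real.log (1 / ε) ^ c ∧
          ‖(w.prod : Matrix n n ℂ) - (U : Matrix n n ℂ)‖ ≤ ε

end SolovayKitaev

section PACC

open MeasureTheory ProbabilityTheory

/-- The standard complex Gaussian measure `𝒩(0,1)_ℂ` on `ℂ`: real and imaginary parts are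
independent centred real Gaussians of variance `1/2`, so that `𝔼 |z|² = 1` and the density is
`π⁻¹ exp (-|z|²)` (Aaronson–Arkhipov 2013, §2 p. 161: "`𝒩(0,1)_ℂ`, the complex Gaussian
distribution with mean `0` and variance `E[|z|²] = 1`"). [cite: AaronsonArkhipovToC2013, §2 p. 161] -/
noncomputable def stdComplexGaussian : Measure ℂ :=
  ((gaussianReal 0 (1 / 2 : NNReal)).prod (gaussianReal 0 (1 / 2 : NNReal))).map
    Complex.measurableEquivRealProd.symm

/-- `stdComplexGaussian` is a probability measure (pushforward of a product of two probability
measures). [folklore] -/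
instance : IsProbabilityMeasure stdComplexGaussian := by
  unfold stdComplexGaussian
  exact Measure.isProbabilityMeasure_map (MeasurableEquiv.measurable _).aemeasurable

/-- The Gaussian matrix ensemble `𝒩(0,1)_ℂ^{n×n}`: the law of an `n × n` array of i.i.d. standard
complex Gaussian entries, as a product measure on `Fin n → Fin n → ℂ` (read as a matrix through
`Matrix.of`). (Aaronson–Arkhipov 2013, §2 p. 161: "`𝒢^{n×n}`, the distribution over `n × n` matrices
with i.i.d. Gaussian entries".) [cite: AaronsonArkhipovToC2013, §2 p. 161] -/
noncomputable def gaussianMatrixMeasure (n : ℕ) : Measure (Fin n → Fin n → ℂ) :=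
  Measure.pi fun _ => Measure.pi fun _ => stdComplexGaussian

/-- The Gaussian matrix ensemble is a probability measure (finite product of probability
measures). [folklore] -/
instance (n : ℕ) : IsProbabilityMeasure (gaussianMatrixMeasure n) := by
  unfold gaussianMatrixMeasure; infer_instance

/-- **quantum-advantage.S18** (Permanent Anti-Concentration Conjecture, PACC; Aaronson–Arkhipov,
*The computational complexity of linear optics*, Theory of Computing 9 (2013) 143–252, §1.2.3,
Conjecture 1.6, eq. (1.3), p. 153 — "Conjecture 6" in the arXiv:1011.3245 numbering). There exists
a polynomial `p` such that for all `n` and all `δ > 0`,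
`Pr_{X ∼ 𝒩(0,1)_ℂ^{n×n}} [ |Per X| < √(n!) / p(n, 1/δ) ] < δ`.
The polynomial is taken of the form `p(n, 1/δ) = C (n+1)^k (1 + 1/δ)^k` with `C > 0` (see the
module docstring for why this is equivalent to quantifying over positive-valued polynomials — the
intended reading, since a sign-changing `p` would make the printed event empty and the printed
statement vacuous).
Status (as of 2026-08): a CONJECTURE in the source (and open problem (2) of its §10, p. 236),
stated here as a `Prop` without `_holds`. Posed 2011/2013 and reported unresolved as late as
Rivin, arXiv:2602.10141 (Feb 2026), §7.4, §8.1 and §8.3. A proof is ANNOUNCED in the preprint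
Koehler–Leung, *Anticoncentration of the permanent in Ginibre ensembles*, arXiv:2607.20329v1
(22 July 2026, 110 pp.; bib key `KoehlerLeung2026`), Theorem 1.1, whose case `K = ℂ` reads
`sup_z Pr[|Per G_n - z| ≤ ε √(n!)] ≲ n ε²` for all `n ≥ 1`, `ε > 0` ("In particular, PACC
holds", p. 2); it is unrefereed at the time of writing and is not vendored here. A discharge from
a bound of that shape is the proved one-line reduction
`PermanentAntiConcentrationConjecture.of_smallBall_sq` in `QuantumAdvantageWave0Proofs.lean`;
more generally the "equivalent formulation" (8.2) of §8, p. 218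
(`Pr[|Per X| < ε √(n!)] < C n^D ε^β`) implies PACC by
`PermanentAntiConcentrationConjecture.of_smallBall` there. What the source itself proves towards
PACC (§8: `𝔼 |Per X|² = n!`; Lemma 8.8, `𝔼 |Per X|⁴ = (n+1)(n!)²`; Theorem 8.6, weak
anti-concentration `Pr[|Per X|² ≥ α · n!] > (1-α)²/(n+1)`) is formalised (proved) in
`GaussianPermanentMoments.lean` and `GaussianPermanentFourthMoment.lean`.
[cite: AaronsonArkhipovToC2013, §1.2.3 Conj. 1.6 p. 153] -/
@[conjecture] def PermanentAntiConcentrationConjecture : Prop :=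
  ∃ (C : ℝ) (k : ℕ), 0 < C ∧ ∀ (n : ℕ) (δ : ℝ), 0 < δ →
    (gaussianMatrixMeasure n).real
        {X | ‖(Matrix.of X).permanent‖ <
          Real.sqrt (n.factorial : ℝ) / (C * ((n : ℝ) + 1) ^ k * (1 + δ⁻¹) ^ k)} < δ

end PACC

section SolovayKitaevDischarge

variable {n : Type*} [Fintype n] [DecidableEq n]

/-- **Discharge of `solovay_kitaev` (quantum-advantage.S07).**  The Solovay–Kitaev theorem as
stated above holds: the proof follows Dawson–Nielsen, *The Solovay–Kitaev algorithm*, QIC **6**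
(2006), Theorem 1 with the `SU(d)` modifications of their §5 — basic `ε₀`-net by density and
compactness (`SolovayKitaev.exists_length_forall_wordApprox`), balanced group commutators from a
traceless logarithm and their Lemma 2 (`SolovayKitaev.exists_balanced_commutator`), error
cancellation in commutators of approximants (their Lemma 1, `SolovayKitaev.norm_comm_sub_comm_le`),
and the recursion `ε_k ↦ K ε_k^{3/2}`, `l_k ↦ 5 l_k` analysed in
`SolovayKitaev.exists_consts_length_le_log_rpow` (exponent `c = log 5 / log (3/2)`).  All files
`SolovayKitaev/{Basic, Words, Diagonal, LieCommutator, BalancedCommutator, Net, Shrink}.lean` are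
sorry-free proof infrastructure. [cite: DawsonNielsen2006, Theorem 1] -/
theorem solovay_kitaev_holds : solovay_kitaev (n := n) := by
  intro G hG
  exact SolovayKitaev.exists_consts_length_le_log_rpow hG.inv_mem hG.dense_closure

end SolovayKitaevDischarge

end Literature.Computability.QuantumComplexity
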